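import Literature.NumberTheory.Automorphic.ParabolicInduction
import Literature.NumberTheory.Automorphic.SmoothCharacter
import Literature.NumberTheory.Automorphic.UnipotentRadicalCompactOpenProofs
import Literature.NumberTheory.Automorphic.ReductiveGroupData
import HarnessLib

/-!
# Van Dijk's formula for the character of a parabolically induced representation of `GL_N(F)`: the STATEMENT
# `Tr (Ind_{P_c}^{GL_N} χ)(f dν) = (ν(K)∕ν_M(M ∩ K)) · ∫_{M_c} χ(m) · f̄^P(m) dν_M(m)` (van Dijk 1972; Bernstein–Zelevinsky 1977 §2.3; Rogawski 1990 Lemma 4.13.1 (b))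

Topic `NumberTheory/Automorphic`; namespace `Literature.NumberTheory.Automorphic`.  ONE DEFINITION (a `Prop`-valued predicate with body) + its unfolding lemma; no
instance, no notation, no axiom, no `sorry`; NOT asserted anywhere in this file.  Cell `pub/hodgecm-mathlib`, line «CMCharIdentityTest» (F0P3b desk, ED. 6):
the GL-level joint of the stub `stub_vanDijkSplit` [Rogawski1990, Lemma 4.13.1 (b): «`χ_{i_G(ξ)}(f) = ξ(f̄^P)` — standard»], so that the split-place identity
`charDist ξ_v νH (cmSplitTransfer … f) = Tr (i_G(ξ_w ⊗ μ_w∘det₀) ∘ e′)(f)` is the CM DICTIONARY applied to THIS predicate at `F = L_w`, `c = lastBlockLabel 3`,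
`χ = maxParabolicLeviChar (ν₀) (ψ_w)` (sequel `Rogawski1990/VanDijkSplitOfGL`).

THE PRINT.  [vanDijk1972] (G. van Dijk, *Computation of certain induced characters of 𝔭-adic groups*, Math. Ann. 199 (1972) 229–240, Thm. p. 237) and
[BernsteinZelevinsky1977, §2.3]: for a parabolic `P = MU` of a reductive 𝔭-adic group `G = KP`, a smooth character (or admissible representation) `χ` of `M`
and `f ∈ C_c^∞(G)`, `tr (Ind_P^G(χ ⊗ δ_P^{1∕2}))(f dg) = ∫_M χ(m) f̄^P(m) dm`, `f̄^P(m) = δ_P(m)^{1∕2} ∫_K ∫_U f(k m u k⁻¹) du dk`, when `dg = dk dm du` (`vol K = 1`);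
[Rogawski1990, §4.13 Lemma 4.13.1 (b) p. 64]: «if `f^P` is defined using measures for which (a) holds, then `χ_{i_G(ξ)}(f) = ξ(f^P)`».

THE TREE'S CURRENCY.  `Ind` = ★ `Representation.parabolicIndGL F c σ` (normalised by ★ `rootDeltaChar`, `ParabolicGL`) at `σ = (trivial).twist χ` — EXACTLY the
representation of ★ `Rogawski1990.splitMemberGL` (`c = Zelevinsky1980.lastBlockLabel 3`, `χ = maxParabolicLeviChar F 3 ν₀ χ′`); the character = ★
`Representation.smoothTrace ρ ν f` (`SmoothCharacter`, Getz–Hahn (8.15)); test functions = locally constant with compact support; `K = GL_N(𝒪)` = ★ `glInt`;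
`M_c`, `U_c`, `P_c` = ★ `standardLeviGL ∕ unipotentRadicalGL ∕ standardParabolicGL`; `f̄^P` written with THE normalised measures `κ(K) = 1`, `μ_U(U_c ∩ K) = 1`
(Mathlib `haarMeasure` on positive compacts, as in ★ `UnitaryGroup.splitKUMeasure`) and with the Iwasawa constant `ν(K)∕ν_M(M_c ∩ K)` INSIDE the statement, so
that it holds verbatim for ARBITRARY Haar measures `ν` on `GL_N(F)` and `ν_M` on `M_c` (both sides scale like `ν(K)`; at `ν(K) = ν_M(M_c ∩ K) = 1` it is print's
formula) — the same convention as ★ `UnitaryGroup.cmSplitTransfer`.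
* **`VanDijkTraceParabolicIndGL F c χ ν νM : Prop`** and `vanDijkTraceParabolicIndGL_iff` (`Iff.rfl`).
HONEST LABEL: HC_CM is proved only modulo the printed citations (2 remaining named inputs hLiu418, h413) until rung 0 closes; this file states a printed theorem
as a predicate and proves nothing about it (it is consumed as the hypothesis of `stub_vanDijkGL` until a GL-currency hand pays it).

## References
* [vanDijk1972] G. van Dijk, *Computation of certain induced characters of 𝔭-adic groups*, Math. Ann. 199 (1972), 229–240.
* [BernsteinZelevinsky1977] I. N. Bernstein, A. V. Zelevinsky, *Induced representations of reductive 𝔭-adic groups I*, Ann. Sci. ÉNS 10 (1977), §2.3.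
* [Rogawski1990] J. D. Rogawski, *Automorphic Representations of Unitary Groups in Three Variables*, Ann. of Math. Stud. 123 (1990), §4.13 Lemma 4.13.1 (b) p. 64.
* [GetzHahn2024] J. Getz, H. Hahn, *An Introduction to Automorphic Representations* (2024), §8.5 (8.15), §8.6 Prop. 8.6.1.
-/

set_option autoImplicit false

noncomputable section

open MeasureTheory MeasureTheory.Measure TopologicalSpace
open scoped MatrixGroups NNReal ENNReal

namespace Literature.NumberTheory.Automorphic

open Literature.NumberTheory.GaloisRepresentations.IsNonarchimedeanLocalField

variable (F : Type*) [Field F] [ValuativeRel F] [TopologicalSpace F] [IsNonarchimedeanLocalField F]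
  {N : ℕ} {α : Type*} [LinearOrder α] [Fintype α] (c : Fin N → α)

/-- **Van Dijk's formula for `Ind_{P_c}^{GL_N}(χ)` AS A PREDICATE on a pair of Haar measures `(ν, ν_M)`**: for every locally constant compactly supported
`f : GL_N(F) → ℂ`,
`tr (parabolicIndGL F c (𝟙.twist χ))(f dν) = (ν(K)∕ν_M(M_c ∩ K)) · ∫_{M_c} χ(blocks m) · δ_{P_c}^{1∕2}(m) · (∫_{K × U_c} f(k (m u) k⁻¹) d(κ ⊗ μ_U)) dν_M(m)`,
`K = GL_N(𝒪)` with `κ(K) = 1`, `μ_U(U_c ∩ K) = 1` (Borel structures from the topology of `GL_N(F)`).  A printed theorem [vanDijk1972; BernsteinZelevinsky1977 §2.3]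
stated, not proved. [cite: Rogawski1990, §4.13 Lemma 4.13.1 (b) p. 64] [cite: BernsteinZelevinsky1977, §2.3] -/
def VanDijkTraceParabolicIndGL (χ : (Π a, GL {i : Fin N // c i = a} F) →* ℂˣ)
    [MeasurableSpace (GL (Fin N) F)] (ν : Measure (GL (Fin N) F)) (νM : Measure ↥(standardLeviGL F c)) : Prop :=
  ∀ f : GL (Fin N) F → ℂ, IsLocallyConstant f → HasCompactSupport f →
    (Representation.parabolicIndGL F c ((Representation.trivial ℂ (Π a, GL {i : Fin N // c i = a} F) ℂ).twist χ)).smoothTrace ν f =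
      (((ν (glInt N F : Set (GL (Fin N) F))).toReal / (νM {m | (m : GL (Fin N) F) ∈ glInt N F}).toReal : ℝ) : ℂ) *
        ∫ m : ↥(standardLeviGL F c),
          ((χ (leviProjection F c ⟨(m : GL (Fin N) F), standardLeviGL_le F c m.2⟩) : ℂˣ) : ℂ) *
            (((rootDeltaChar (standardParabolicGL F c) ⟨(m : GL (Fin N) F), standardLeviGL_le F c m.2⟩ : ℂˣ) : ℂ) *
              (letI : MeasurableSpace (GL (Fin N) F) := borel _
               haveI : BorelSpace (GL (Fin N) F) := ⟨rfl⟩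
               ∫ q : ↥(glInt N F) × ↥(unipotentRadicalGL F c),
                 f ((q.1 : GL (Fin N) F) * ((m : GL (Fin N) F) * (q.2 : GL (Fin N) F)) * (q.1 : GL (Fin N) F)⁻¹)
                 ∂((haarMeasure (⟨⟨Set.univ, isCompact_iff_isCompact_univ.1 (isCompact_glInt (n := N) (F := F))⟩, by
                       simp only [interior_univ, Set.univ_nonempty]⟩ : PositiveCompacts ↥(glInt N F))).prod
                   (haarMeasure (⟨⟨((↑) : ↥(unipotentRadicalGL F c) → GL (Fin N) F) ⁻¹' (glInt N F : Set (GL (Fin N) F)),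
                       haveI := (isLocalField F).toT2Space
                       (isClosed_unipotentRadicalGL (R := F) c).isClosedEmbedding_subtypeVal.isCompact_preimage (isCompact_glInt (n := N) (F := F))⟩,
                       ⟨1, ((isOpen_glInt (n := N) (F := F)).preimage continuous_subtype_val).interior_eq.symm ▸ (glInt N F).one_mem⟩⟩ :
                       PositiveCompacts ↥(unipotentRadicalGL F c))))))
          ∂νM

/-- Unfolding of `VanDijkTraceParabolicIndGL`. [cite: Rogawski1990, §4.13 Lemma 4.13.1 (b) p. 64] -/
theorem vanDijkTraceParabolicIndGL_iff (χ : (Π a, GL {i : Fin N // c i = a} F) →* ℂˣ)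
    [MeasurableSpace (GL (Fin N) F)] (ν : Measure (GL (Fin N) F)) (νM : Measure ↥(standardLeviGL F c)) :
    VanDijkTraceParabolicIndGL F c χ ν νM ↔
      ∀ f : GL (Fin N) F → ℂ, IsLocallyConstant f → HasCompactSupport f →
        (Representation.parabolicIndGL F c ((Representation.trivial ℂ (Π a, GL {i : Fin N // c i = a} F) ℂ).twist χ)).smoothTrace ν f =
          (((ν (glInt N F : Set (GL (Fin N) F))).toReal / (νM {m | (m : GL (Fin N) F) ∈ glInt N F}).toReal : ℝ) : ℂ) *
            ∫ m : ↥(standardLeviGL F c),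
              ((χ (leviProjection F c ⟨(m : GL (Fin N) F), standardLeviGL_le F c m.2⟩) : ℂˣ) : ℂ) *
                (((rootDeltaChar (standardParabolicGL F c) ⟨(m : GL (Fin N) F), standardLeviGL_le F c m.2⟩ : ℂˣ) : ℂ) *
                  (letI : MeasurableSpace (GL (Fin N) F) := borel _
                   haveI : BorelSpace (GL (Fin N) F) := ⟨rfl⟩
                   ∫ q : ↥(glInt N F) × ↥(unipotentRadicalGL F c),
                     f ((q.1 : GL (Fin N) F) * ((m : GL (Fin N) F) * (q.2 : GL (Fin N) F)) * (q.1 : GL (Fin N) F)⁻¹)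
                     ∂((haarMeasure (⟨⟨Set.univ, isCompact_iff_isCompact_univ.1 (isCompact_glInt (n := N) (F := F))⟩, by
                           simp only [interior_univ, Set.univ_nonempty]⟩ : PositiveCompacts ↥(glInt N F))).prod
                       (haarMeasure (⟨⟨((↑) : ↥(unipotentRadicalGL F c) → GL (Fin N) F) ⁻¹' (glInt N F : Set (GL (Fin N) F)),
                           haveI := (isLocalField F).toT2Space
                           (isClosed_unipotentRadicalGL (R := F) c).isClosedEmbedding_subtypeVal.isCompact_preimage (isCompact_glInt (n := N) (F := F))⟩,
                           ⟨1, ((isOpen_glInt (n := N) (F := F)).preimage continuous_subtype_val).interior_eq.symm ▸ (glInt N F).one_mem⟩⟩ :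
                           PositiveCompacts ↥(unipotentRadicalGL F c))))))
              ∂νM :=
  Iff.rfl

end Literature.NumberTheory.Automorphic

end
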